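import Summits.AtomisticToContinuum.BoseEinsteinCondensation.Theorems.BECThomsonPrincipleGDTransferDefs
import Summits.AtomisticToContinuum.BoseEinsteinCondensation.Theorems.BECThomsonPrincipleGDTransferChordVariationSrcPair
import Summits.AtomisticToContinuum.BoseEinsteinCondensation.Theorems.BECThomsonPrincipleGDTransferChordVariationForms
import Summits.AtomisticToContinuum.BoseEinsteinCondensation.Theorems.BECThomsonPrincipleGDTransferChordVariationKLS

/-!
# Route `BECThomsonPrinciple`, crux `GDTransfer` (stmt-AtomisticToContinuum-9482), line `dyson-dressed-witness`:
# stub `chordVariation` — `GaussianDominationCan → TwoSidedDualNorm`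

The registered stub `stub_chordVariation : Sig.stub_chordVariation` of the line (the ONLY place the
antecedent Gaussian domination is consumed): the variational `T = 0` Kennedy–Lieb–Shastry step.  Unfold
GD (`Negative.gaussianDominationCan_iff`) and keep its constants `ρ₀, C, N₀`.  Given `η, R`, choose
`t ≤ 1` with `CL²(1+8R)(4R)·t ≤ η/2` and then the slack `δ` with `CL²(2+8R)·δ ≤ (η/2)t²`.  For a
`δ`-near-minimiser `Ψ`, a window mode `n` (`C_k = CL²/‖n‖² ≤ CL²`) and directions `ζ±` of mass and
form `≤ R`, part 3 (`ChordVariation.variation_estimate`, GD along `Ψ ± tζ`) gives for every test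
direction `ζ` the bound `(N|σ(ζ,Ψ) + σ(Ψ,ζ)|)² ≤ C_k μ̄ q̃(ζ) + C_k μ̄ δ/t²`,
`μ̄ = 1 + t + (t+t²)‖ζ‖²`.  TWO-SIDEDNESS by the phase trick with the two test directions
`ζ₁ = ζ₊ + ζ₋` and `ζ₂ = iζ₊ − iζ₋`: their pairings are `A + B` and `i(B − A)` with
`A = σ(ζ₊,Ψ) + σ(Ψ,ζ₋)`, `B = σ(ζ₋,Ψ) + σ(Ψ,ζ₊)`, and `max(|A+B|, |A−B|) ≥ |A|` (parallelogram law in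
`ℂ`); both have `q̃ ≤ 2q̃(ζ₊) + 2q̃(ζ₋)`, mass `≤ 4R` (parallelogram law, `q̃ ≥ 0`, unimodular
scaling; `ChordVariation.excess_add_le`).  The real-arithmetic endgame (`ChordVariation.endgame`) yields
`(N|A|)² ≤ 2C_k(q̃(ζ₊) + q̃(ζ₋)) + η`, which is the displayed `ℝ≥0∞` inequality of `TwoSidedDualNorm`.
[folklore] (KennedyLiebShastry1988 in variational form; arXiv:1211.2778 for the LNSS source).
-/

noncomputable section

open MeasureTheory Filter
open scoped ENNReal NNReal ComplexConjugate

namespace Summit.AtomisticToContinuum.BoseEinsteinCondensation.Cruxes.GDTransfer.DysonDressedWitness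

namespace ChordVariation

open Literature.MathematicalPhysics.QuantumManyBody.BoseGas
open Summit.AtomisticToContinuum.BoseEinsteinCondensation.Theorems.GaussianDominationCan.Negative

/-! ## Real-arithmetic endgame -/

/-- For `K ≥ 0` and `ε > 0` there is `0 < t ≤ 1` with `K t ≤ ε` (`t = min 1 (ε/(K+1))`). [folklore] -/
theorem exists_small_mul_le {K ε : ℝ} (hK : 0 ≤ K) (hε : 0 < ε) :
    ∃ t : ℝ, 0 < t ∧ t ≤ 1 ∧ K * t ≤ ε := by
  refine ⟨min 1 (ε / (K + 1)), lt_min one_pos (by positivity), min_le_left _ _, ?_⟩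
  calc K * min 1 (ε / (K + 1)) ≤ K * (ε / (K + 1)) :=
        mul_le_mul_of_nonneg_left (min_le_right _ _) hK
    _ = K / (K + 1) * ε := by ring
    _ ≤ 1 * ε := by
        gcongr
        exact (div_le_one (by positivity)).mpr (by linarith)
    _ = ε := one_mul ε

/-- **Endgame.** With `μ̄ = 1 + t + (t + t²)m'`, `m' ≤ 4R`, `q' ≤ 2Q`, `Q ≤ 2R`, `qψ ≤ δ`, `C_k ≤ CL²`,
`t ≤ 1`, `CL²(1+8R)(4R)t ≤ η/2` and `CL²(2+8R)δ ≤ (η/2)t²`: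
`Y ≤ X ≤ C_k μ̄ q' + C_k μ̄ qψ/t²` implies `Y ≤ 2C_kQ + η`. [folklore] -/
theorem endgame {η R CL Γ t δr m' q' Q qψ X Y : ℝ} (hR : 0 < R) (hCL : 0 ≤ CL) (hΓ0 : 0 ≤ Γ)
    (hΓ : Γ ≤ CL) (ht0 : 0 < t) (ht1 : t ≤ 1) (htK : CL * (1 + 8 * R) * (4 * R) * t ≤ η / 2)
    (hδK : CL * (2 + 8 * R) * δr ≤ η / 2 * t ^ 2) (hm'0 : 0 ≤ m')
    (hm'R : m' ≤ 4 * R) (hq' : q' ≤ 2 * Q) (hQ0 : 0 ≤ Q) (hQR : Q ≤ 2 * R) (hqψ0 : 0 ≤ qψ)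
    (hqψ : qψ ≤ δr)
    (hX : X ≤ Γ * ((1 + t) + (t + t ^ 2) * m') * q' + Γ * ((1 + t) + (t + t ^ 2) * m') * qψ / t ^ 2)
    (hY : Y ≤ X) :
    Y ≤ 2 * Γ * Q + η := by
  set μb := (1 + t) + (t + t ^ 2) * m' with hμb
  have ht2 : t ^ 2 ≤ t := by nlinarith
  have hμb1 : μb - 1 ≤ t * (1 + 8 * R) := by
    have : (t + t ^ 2) * m' ≤ (2 * t) * (4 * R) :=
      mul_le_mul (by linarith) hm'R hm'0 (by linarith)
    linarith
  have hμb0 : 1 ≤ μb := by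
    have : 0 ≤ (t + t ^ 2) * m' := by positivity
    linarith
  have hμbU : μb ≤ 2 + 8 * R := by nlinarith
  have hΓμ : 0 ≤ Γ * μb := by positivity
  -- term 1
  have hT1 : Γ * μb * q' ≤ 2 * Γ * Q + η / 2 := by
    calc Γ * μb * q' ≤ Γ * μb * (2 * Q) := mul_le_mul_of_nonneg_left hq' hΓμ
      _ = 2 * Γ * Q + 2 * (Γ * (μb - 1) * Q) := by ring
      _ ≤ 2 * Γ * Q + 2 * (CL * (t * (1 + 8 * R)) * (2 * R)) := by
          gcongr 2 * Γ * Q + 2 * ?_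
          exact mul_le_mul (mul_le_mul hΓ hμb1 (sub_nonneg.2 hμb0) hCL) hQR hQ0 (by positivity)
      _ = 2 * Γ * Q + CL * (1 + 8 * R) * (4 * R) * t := by ring
      _ ≤ 2 * Γ * Q + η / 2 := by linarith
  -- term 2
  have hT2 : Γ * μb * qψ / t ^ 2 ≤ η / 2 := by
    rw [div_le_iff₀ (by positivity)]
    calc Γ * μb * qψ ≤ CL * (2 + 8 * R) * δr :=
          mul_le_mul (mul_le_mul hΓ hμbU (by positivity) hCL) hqψ hqψ0 (by positivity)
      _ ≤ η / 2 * t ^ 2 := hδK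
  linarith

end ChordVariation

open Literature.MathematicalPhysics.QuantumManyBody.BoseGas
open Summit.AtomisticToContinuum.BoseEinsteinCondensation.Theorems.GaussianDominationCan.Negative
open ChordVariation

/-- **`stub_chordVariation`: Gaussian domination implies the two-sided dual-norm bound at
near-minimisers** (`GaussianDominationCan → TwoSidedDualNorm`), with GD's own constants `ρ₀, C, N₀`:
the symmetrised variational Kennedy–Lieb–Shastry step (`ChordVariation.variation_estimate`, GD along
`Ψ ± tζ`) at the two test directions `ζ₊ + ζ₋`, `iζ₊ − iζ₋` (phase trick), `q̃` of a sum bounded by the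
parallelogram law, and the explicit slack `δ = (η/2)t²/(CL²(2+8R)+1)`, `t = min 1 ((η/2)/(CL²(1+8R)4R+1))`.
[folklore] -/
theorem stub_chordVariation : Sig.stub_chordVariation := by
  intro hGD v hv M hM
  obtain ⟨ρ₀, C, hρ₀, hC, N₀, hW⟩ := gaussianDominationCan_iff.mp hGD v hv M hM
  refine ⟨ρ₀, C, hρ₀, hC, N₀, ?_⟩
  intro m hm L hL hρL hE₀ η R hη hR
  -- the slack: first `t`, then `δ`
  have hCL : 0 ≤ C * L ^ 2 := by positivity
  obtain ⟨t, ht0, ht1, htK⟩ :=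
    exists_small_mul_le (K := C * L ^ 2 * (1 + 8 * R) * (4 * R)) (by positivity) (half_pos hη)
  obtain ⟨δr, hδr0, -, hδK⟩ :=
    exists_small_mul_le (K := C * L ^ 2 * (2 + 8 * R)) (by positivity)
      (by positivity : 0 < η / 2 * t ^ 2)
  refine ⟨ENNReal.ofReal δr, ENNReal.ofReal_pos.mpr hδr0, ?_⟩
  intro Ψ hΨ n hn hwin ζp ζm hζp hζm hmp hmm hep hem
  have hGDn : ∀ s : ℝ, 0 ≤ s → ∀ Φ : PeriodicTrialState (m + 1) L, GDIneq v m L n C s Φ :=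
    fun s hs Φ => hW m hm L hL hρL n hn hwin s hs Φ
  set E₀ := periodicGroundStateEnergy v (m + 1) L with hE₀def
  set nn : ℝ := ‖(fun j => (n j : ℝ))‖ with hnn
  have hnn1 : 1 ≤ nn := one_le_norm_intVec hn
  set Γ : ℝ := C * L ^ 2 / nn ^ 2 with hΓdef
  have hΓ0 : 0 ≤ Γ := by positivity
  have hΓle : Γ ≤ C * L ^ 2 := by
    rw [hΓdef, div_le_iff₀ (by positivity)]
    have h1 : (1 : ℝ) ≤ nn ^ 2 := by nlinarith
    calc C * L ^ 2 = C * L ^ 2 * 1 := (mul_one _).symm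
      _ ≤ C * L ^ 2 * nn ^ 2 := mul_le_mul_of_nonneg_left h1 hCL
  -- the near-minimiser: finite energy, `0 ≤ q̃(Ψ) ≤ δ`
  have hE₀δ : E₀ + ENNReal.ofReal δr ≠ ⊤ := ENNReal.add_ne_top.2 ⟨hE₀, ENNReal.ofReal_ne_top⟩
  have hΨfin : periodicEnergy v Ψ ≠ ⊤ := ne_top_of_le_ne_top hE₀δ hΨ
  have hqψ : (periodicEnergy v Ψ).toReal - E₀.toReal ≤ δr := by
    have h := ENNReal.toReal_mono hE₀δ hΨ
    rw [ENNReal.toReal_add hE₀ ENNReal.ofReal_ne_top, ENNReal.toReal_ofReal hδr0.le] at h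
    linarith
  have hqψ0 : 0 ≤ (periodicEnergy v Ψ).toReal - E₀.toReal := by
    have h := ENNReal.toReal_mono hΨfin (periodicGroundStateEnergy_le v Ψ)
    linarith
  -- the data of `ζ±` in real numbers
  have hψc : Continuous Ψ.ψ := Ψ.contDiff.continuous
  have hζpc : Continuous ζp := hζp.contDiff.continuous
  have hζmc : Continuous ζm := hζm.contDiff.continuous
  have hepfin : eform v L ζp ≠ ⊤ := ne_top_of_le_ne_top ENNReal.ofReal_ne_top hep
  have hemfin : eform v L ζm ≠ ⊤ := ne_top_of_le_ne_top ENNReal.ofReal_ne_top hem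
  have hmpfin : mass L ζp ≠ ⊤ := mass_ne_top_of_continuous hζpc
  have hmmfin : mass L ζm ≠ ⊤ := mass_ne_top_of_continuous hζmc
  have toR : ∀ {x : ℝ≥0∞}, x ≤ ENNReal.ofReal R → x.toReal ≤ R := fun hx => by
    have h := ENNReal.toReal_mono ENNReal.ofReal_ne_top hx
    rwa [ENNReal.toReal_ofReal hR.le] at h
  have hmpR := toR hmp
  have hmmR := toR hmm
  have hepR := toR hep
  have hemR := toR hem
  have he₀0 : 0 ≤ E₀.toReal := ENNReal.toReal_nonneg
  have hmp0 : 0 ≤ (mass L ζp).toReal := ENNReal.toReal_nonneg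
  have hmm0 : 0 ≤ (mass L ζm).toReal := ENNReal.toReal_nonneg
  have hqp0 : 0 ≤ (eform v L ζp).toReal - E₀.toReal * (mass L ζp).toReal :=
    sub_nonneg.2 (e0_mul_mass_le_eform_toReal v hζp hepfin)
  have hqm0 : 0 ≤ (eform v L ζm).toReal - E₀.toReal * (mass L ζm).toReal :=
    sub_nonneg.2 (e0_mul_mass_le_eform_toReal v hζm hemfin)
  set Q : ℝ := ((eform v L ζp).toReal - E₀.toReal * (mass L ζp).toReal) +
    ((eform v L ζm).toReal - E₀.toReal * (mass L ζm).toReal) with hQdef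
  have hQ0 : 0 ≤ Q := add_nonneg hqp0 hqm0
  have hQR : Q ≤ 2 * R := by
    have h1 : 0 ≤ E₀.toReal * (mass L ζp).toReal := mul_nonneg he₀0 hmp0
    have h2 : 0 ≤ E₀.toReal * (mass L ζm).toReal := mul_nonneg he₀0 hmm0
    rw [hQdef]; linarith
  -- the pairings and the two test directions
  set A : ℂ := srcPair m L n ζp Ψ.ψ + srcPair m L n Ψ.ψ ζm with hA
  set B : ℂ := srcPair m L n ζm Ψ.ψ + srcPair m L n Ψ.ψ ζp with hB
  set ζ₁ : Config (m + 1) → ℂ := fun X => ζp X + ζm X with hζ₁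
  set ζ₂ : Config (m + 1) → ℂ := fun X => Complex.I * ζp X + (-Complex.I) * ζm X with hζ₂
  have hA₁ : srcPair m L n ζ₁ Ψ.ψ + srcPair m L n Ψ.ψ ζ₁ = A + B := by
    have h1 : ζ₁ = ζp + ζm := rfl
    rw [h1, srcPair_add_left n hζpc hζmc hψc, srcPair_add_right n hψc hζpc hζmc, hA, hB]
    ring
  have hIpc : Continuous fun X => Complex.I * ζp X := continuous_const.mul hζpc
  have hImc : Continuous fun X => (-Complex.I) * ζm X := continuous_const.mul hζmc
  have hA₂ : srcPair m L n ζ₂ Ψ.ψ + srcPair m L n Ψ.ψ ζ₂ = Complex.I * (B - A) := by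
    have h2 : ζ₂ = (fun X => Complex.I * ζp X) + (fun X => (-Complex.I) * ζm X) := rfl
    rw [h2, srcPair_add_left n hIpc hImc hψc, srcPair_add_right n hψc hIpc hImc,
      srcPair_const_mul_left, srcPair_const_mul_left, srcPair_const_mul_right,
      srcPair_const_mul_right, map_neg, Complex.conj_I, hA, hB]
    ring
  -- bounds for the test directions
  have hζ₁d : IsDirection m L ζ₁ := dir_add hζp hζm
  obtain ⟨h1fin', h1mass', h1q'⟩ := excess_add_le hv.1 hζp hζm hepfin hemfin
  have h1fin : eform v L ζ₁ ≠ ⊤ := h1fin'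
  have h1mass : (mass L ζ₁).toReal ≤ 2 * (mass L ζp).toReal + 2 * (mass L ζm).toReal := h1mass'
  have h1q : (eform v L ζ₁).toReal - E₀.toReal * (mass L ζ₁).toReal ≤
      2 * ((eform v L ζp).toReal - E₀.toReal * (mass L ζp).toReal) +
        2 * ((eform v L ζm).toReal - E₀.toReal * (mass L ζm).toReal) := h1q'
  have hIp : IsDirection m L (fun X => Complex.I * ζp X) := dir_const_mul hζp _
  have hIm : IsDirection m L (fun X => (-Complex.I) * ζm X) := dir_const_mul hζm _
  have hζ₂d : IsDirection m L ζ₂ := dir_add hIp hIm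
  have hI1 : ‖Complex.I‖₊ = 1 := Complex.nnnorm_I
  have hI2 : ‖(-Complex.I)‖₊ = 1 := by rw [nnnorm_neg, Complex.nnnorm_I]
  have heIp : eform v L (fun X => Complex.I * ζp X) = eform v L ζp :=
    eform_smul_of_nnnorm_eq_one v hI1 hζp.contDiff
  have heIm : eform v L (fun X => (-Complex.I) * ζm X) = eform v L ζm :=
    eform_smul_of_nnnorm_eq_one v hI2 hζm.contDiff
  have hmIp : mass L (fun X => Complex.I * ζp X) = mass L ζp := mass_smul_of_nnnorm_eq_one hI1 ζp
  have hmIm : mass L (fun X => (-Complex.I) * ζm X) = mass L ζm :=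
    mass_smul_of_nnnorm_eq_one hI2 ζm
  obtain ⟨h2fin', h2mass', h2q'⟩ := excess_add_le hv.1 hIp hIm (by rw [heIp]; exact hepfin)
    (by rw [heIm]; exact hemfin)
  rw [hmIp, hmIm] at h2mass'
  rw [heIp, heIm, hmIp, hmIm] at h2q'
  have h2fin : eform v L ζ₂ ≠ ⊤ := h2fin'
  have h2mass : (mass L ζ₂).toReal ≤ 2 * (mass L ζp).toReal + 2 * (mass L ζm).toReal := h2mass'
  have h2q : (eform v L ζ₂).toReal - E₀.toReal * (mass L ζ₂).toReal ≤
      2 * ((eform v L ζp).toReal - E₀.toReal * (mass L ζp).toReal) +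
        2 * ((eform v L ζm).toReal - E₀.toReal * (mass L ζm).toReal) := h2q'
  -- the phase trick: `max(|A + B|, |A − B|) ≥ |A|`
  have hparAB := parallelogram_law_with_norm ℂ A B
  have hchoice : ‖A‖ ^ 2 ≤ ‖A + B‖ ^ 2 ∨ ‖A‖ ^ 2 ≤ ‖A - B‖ ^ 2 := by
    by_contra h
    simp only [not_or, not_le] at h
    nlinarith [hparAB, sq_nonneg ‖B‖, h.1, h.2]
  -- the symmetrised variation at the chosen test direction
  set N : ℝ := ((m + 1 : ℕ) : ℝ) with hNdef
  have hfinal : (N * ‖A‖) ^ 2 ≤ 2 * Γ * Q + η := by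
    rcases hchoice with hc | hc
    · have hX := variation_estimate hv.1 hGDn hC hL hn Ψ hΨfin hζ₁d h1fin ht0
      rw [hA₁] at hX
      have hY : (N * ‖A‖) ^ 2 ≤ (N * ‖A + B‖) ^ 2 := by
        rw [mul_pow, mul_pow]; exact mul_le_mul_of_nonneg_left hc (sq_nonneg _)
      have hm'R : (mass L ζ₁).toReal ≤ 4 * R := by linarith
      have hq'0 := sub_nonneg.2 (e0_mul_mass_le_eform_toReal v hζ₁d h1fin)
      have hq' : (eform v L ζ₁).toReal - E₀.toReal * (mass L ζ₁).toReal ≤ 2 * Q :=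
        h1q.trans_eq (by rw [hQdef]; ring)
      exact endgame hR hCL hΓ0 hΓle ht0 ht1 htK hδK ENNReal.toReal_nonneg hm'R hq' hQ0 hQR hqψ0
        hqψ hX hY
    · have hX := variation_estimate hv.1 hGDn hC hL hn Ψ hΨfin hζ₂d h2fin ht0
      rw [hA₂] at hX
      have hnorm : ‖Complex.I * (B - A)‖ = ‖A - B‖ := by
        rw [norm_mul, Complex.norm_I, one_mul, norm_sub_rev]
      rw [hnorm] at hX
      have hY : (N * ‖A‖) ^ 2 ≤ (N * ‖A - B‖) ^ 2 := by
        rw [mul_pow, mul_pow]; exact mul_le_mul_of_nonneg_left hc (sq_nonneg _)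
      have hm'R : (mass L ζ₂).toReal ≤ 4 * R := by linarith
      have hq'0 := sub_nonneg.2 (e0_mul_mass_le_eform_toReal v hζ₂d h2fin)
      have hq' : (eform v L ζ₂).toReal - E₀.toReal * (mass L ζ₂).toReal ≤ 2 * Q :=
        h2q.trans_eq (by rw [hQdef]; ring)
      exact endgame hR hCL hΓ0 hΓle ht0 ht1 htK hδK ENNReal.toReal_nonneg hm'R hq' hQ0 hQR hqψ0
        hqψ hX hY
  -- back to `ℝ≥0∞`
  have h2Γ : 2 * C * L ^ 2 / nn ^ 2 = 2 * Γ := by rw [hΓdef]; ring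
  have h2Γ0 : 0 ≤ 2 * Γ := by positivity
  have hreal : (N * ‖A‖) ^ 2 + 2 * Γ * (E₀.toReal * ((mass L ζp).toReal + (mass L ζm).toReal)) ≤
      2 * Γ * ((eform v L ζp).toReal + (eform v L ζm).toReal) + η := by
    rw [hQdef] at hfinal
    linarith
  rw [h2Γ]
  calc ENNReal.ofReal ((N * ‖A‖) ^ 2) +
        ENNReal.ofReal (2 * Γ) * E₀ * (mass L ζp + mass L ζm)
      = ENNReal.ofReal ((N * ‖A‖) ^ 2 +
          2 * Γ * (E₀.toReal * ((mass L ζp).toReal + (mass L ζm).toReal))) := by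
        rw [ENNReal.ofReal_add (sq_nonneg _) (by positivity), ENNReal.ofReal_mul h2Γ0,
          ENNReal.ofReal_mul he₀0, ENNReal.ofReal_add hmp0 hmm0, ENNReal.ofReal_toReal hE₀,
          ENNReal.ofReal_toReal hmpfin, ENNReal.ofReal_toReal hmmfin, mul_assoc]
    _ ≤ ENNReal.ofReal (2 * Γ * ((eform v L ζp).toReal + (eform v L ζm).toReal) + η) :=
        ENNReal.ofReal_le_ofReal hreal
    _ = ENNReal.ofReal (2 * Γ) * (eform v L ζp + eform v L ζm) + ENNReal.ofReal η := by
        rw [ENNReal.ofReal_add (by positivity) hη.le, ENNReal.ofReal_mul h2Γ0,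
          ENNReal.ofReal_add ENNReal.toReal_nonneg ENNReal.toReal_nonneg,
          ENNReal.ofReal_toReal hepfin, ENNReal.ofReal_toReal hemfin]

end Summit.AtomisticToContinuum.BoseEinsteinCondensation.Cruxes.GDTransfer.DysonDressedWitness

end
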